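import Mathlib.Analysis.Calculus.DerivativeTest
import Mathlib.Analysis.Calculus.Deriv.Add
import Mathlib.Analysis.Calculus.Deriv.Pow
import Mathlib.Analysis.Calculus.LocalExtr.Basic
import Mathlib.Topology.Order.Compact
import Mathlib.Algebra.BigOperators.Group.Finset.Basic
import HarnessLib

/-!
# The port-cube maximum principle (analytic core of the gen-25 reduction `(MAXDIR) ⟹ V4`)

Support file for crux `stmt-CriticalPhenomena-4575` (`NoHeavyLowerTail`), seat `prim-l12-p1` gen 25
(`--supports stmt-CriticalPhenomena-4575`); memo `run/shared/lean/prim/prim-l12/FROM-prim-l12-p1-g25-PORT-CUBE-MAXPRINCIPLE.md` §1.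
No definitions, no sorries, standard axioms; pure real analysis (Mathlib only).

The super-terminal quartic isolation law `V4` (whose face is the reverse-Harris row `P3_{1/2}`, which gives the two-sided cluster bound TCB
and TT-CHORD for `E₃`, cf. `…IncStarTwoSidedClusterBoundOneSided`, `…ThreePointIsoQuarticFace`) reads `Φ₄ ≤ I'_c` with every coordinate
MULTI-AFFINE in the weights `r ∈ [0,1]^k` of the `k` pairs at the port `c`.  On the boundary of that cube the law is the law of a graph with
fewer positive pairs; so `V4` follows by induction on the number of positive pairs from the following elementary fact, proved here:

* `not_isLocalMax_of_hasDerivAt_deriv_pos` — a real function with a (local) derivative function `g'` differentiable at `t` with `g''(t) > 0`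
  has no local maximum at `t` (second-derivative test, contrapositive form);
* `cube_maximum_principle` — if `f` is continuous on the closed cube `[0,1]^k`, `f ≤ 0` on its boundary, and at every INTERIOR point some
  coordinate direction `i` has second derivative `∂ᵢ²f ≥ 0`, then `f ≤ 0` on the whole cube (perturb by `ε·Σ xᵢ²`, take an argmax on the
  compact cube, and apply the first lemma along the convex coordinate line).
The combinatorial hypothesis "(MAXDIR): some pair at the port is a convex direction of `Φ₄ = Q'⁴/(I'_A I'_b)²`" is what remains open (memo §4–§5:
it survives adversarial search to `n = 8`; every termwise/averaged decrement condition is false).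
-/

namespace Summit.CriticalPhenomena.PercolationContinuityZ3.Theorems.PortCubeMaxPrinciple

open Filter Topology Set

/-! ## One dimension: no local maximum where the second derivative is positive -/

/-- **Second-derivative test, contrapositive form.**  If `g` has derivative `g' s` at every `s` near `t`, and `g'` has derivative `D > 0`
at `t`, then `t` is not a local maximum of `g`.  (At a local maximum `g'(t) = 0`, so Mathlib's second-derivative test makes `t` a local
minimum as well; then `g` is locally constant, its derivative vanishes near `t`, and `g''(t) = 0`, contradiction.) [this work] -/
theorem not_isLocalMax_of_hasDerivAt_deriv_pos {g g' : ℝ → ℝ} {t D : ℝ}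
    (hg : ∀ᶠ s in 𝓝 t, HasDerivAt g (g' s) s) (hD : HasDerivAt g' D t) (hpos : 0 < D) :
    ¬ IsLocalMax g t := by
  intro hmax
  have hderiv : deriv g =ᶠ[𝓝 t] g' := hg.mono fun s hs => hs.deriv
  have hdd : deriv (deriv g) t = D := by rw [hderiv.deriv_eq]; exact hD.deriv
  have hcont : ContinuousAt g t := (hg.self_of_nhds).continuousAt
  have hzero : deriv g t = 0 := hmax.deriv_eq_zero
  have hmin : IsLocalMin g t := isLocalMin_of_deriv_deriv_pos (by rw [hdd]; exact hpos) hzero hcont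
  -- `g` is locally constant near `t`
  have hconst : ∀ᶠ s in 𝓝 t, g s = g t := by
    filter_upwards [hmax, hmin] with s h1 h2 using le_antisymm h1 h2
  -- hence `deriv g` vanishes near `t`
  have hderiv0 : deriv g =ᶠ[𝓝 t] fun _ => 0 := by
    filter_upwards [hconst.eventually_nhds] with s hs
    have hloc : g =ᶠ[𝓝 s] fun _ => g t := hs
    rw [hloc.deriv_eq]
    exact deriv_const s (g t)
  have : deriv (deriv g) t = 0 := by
    rw [hderiv0.deriv_eq]; exact deriv_const t (0 : ℝ)
  rw [hdd] at this
  exact absurd this hpos.ne'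

/-! ## The cube `[0,1]^k` -/

variable {k : ℕ}

/-- Updating one coordinate of a point of the cube by a value in `[0,1]` stays in the cube. [folklore] -/
theorem update_mem_Icc {x : Fin k → ℝ} (hx : x ∈ Icc (0 : Fin k → ℝ) 1) (i : Fin k) {s : ℝ} (hs : s ∈ Icc (0 : ℝ) 1) :
    Function.update x i s ∈ Icc (0 : Fin k → ℝ) 1 := by
  refine ⟨fun j => ?_, fun j => ?_⟩
  · rcases eq_or_ne j i with rfl | hne
    · simp [hs.1]
    · rw [Function.update_of_ne hne]; exact hx.1 j
  · rcases eq_or_ne j i with rfl | hne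
    · simp [hs.2]
    · rw [Function.update_of_ne hne]; exact hx.2 j

/-- On the cube, `Σ xᵢ² ≤ k`. [folklore] -/
theorem sum_sq_le_card {x : Fin k → ℝ} (hx : x ∈ Icc (0 : Fin k → ℝ) 1) : ∑ i, x i ^ 2 ≤ (k : ℝ) := by
  calc ∑ i, x i ^ 2 ≤ ∑ _i : Fin k, (1 : ℝ) := by
        refine Finset.sum_le_sum fun i _ => ?_
        have h0 := hx.1 i; have h1 := hx.2 i
        simp only [Pi.zero_apply, Pi.one_apply] at h0 h1
        nlinarith
    _ = (k : ℝ) := by simp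

/-- Derivative of the perturbation `s ↦ ε·Σⱼ (update x i s)ⱼ²` along the `i`-th coordinate line: `2ε s`. [folklore] -/
theorem hasDerivAt_perturb (x : Fin k → ℝ) (i : Fin k) (ε s : ℝ) :
    HasDerivAt (fun s => ε * ∑ j, (Function.update x i s j) ^ 2) (ε * (2 * s)) s := by
  have hsum : HasDerivAt (fun s => ∑ j, (Function.update x i s j) ^ 2) (∑ j : Fin k, if j = i then 2 * s else 0) s := by
    refine HasDerivAt.fun_sum fun j _ => ?_
    rcases eq_or_ne j i with rfl | hne
    · simp only [Function.update_self, if_true]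
      simpa using (hasDerivAt_pow 2 s)
    · simp only [Function.update_of_ne hne, hne, if_false]
      exact hasDerivAt_const s _
  have : (∑ j : Fin k, if j = i then 2 * s else 0) = 2 * s := by simp
  rw [this] at hsum
  exact hsum.const_mul ε

/-- **The cube maximum principle.**  Let `f : [0,1]^k → ℝ` be continuous on the closed cube, `≤ 0` at every boundary point (some coordinate
`0` or `1`), and suppose that at every interior point `x` SOME coordinate direction `i` is convex to second order: the line function
`s ↦ f(x with xᵢ := s)` has a derivative function near `xᵢ` which is differentiable at `xᵢ` with derivative `D ≥ 0`.  Then `f ≤ 0` on the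
whole cube.  (Proof: `f + ε·Σxᵢ²` attains its maximum on the compact cube; at an interior point the chosen line has second derivative
`D + 2ε > 0`, impossible at a maximum by `not_isLocalMax_of_hasDerivAt_deriv_pos`; so the maximum is on the boundary, `f ≤ kε`, let `ε → 0`.) [this work] -/
theorem cube_maximum_principle (f : (Fin k → ℝ) → ℝ) (hcont : ContinuousOn f (Icc (0 : Fin k → ℝ) 1))
    (hbdry : ∀ x ∈ Icc (0 : Fin k → ℝ) 1, (∃ i, x i = 0 ∨ x i = 1) → f x ≤ 0)
    (hdir : ∀ x : Fin k → ℝ, (∀ i, 0 < x i ∧ x i < 1) →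
      ∃ i : Fin k, ∃ g' : ℝ → ℝ, ∃ D : ℝ, 0 ≤ D ∧
        (∀ᶠ s in 𝓝 (x i), HasDerivAt (fun s => f (Function.update x i s)) (g' s) s) ∧ HasDerivAt g' D (x i)) :
    ∀ x ∈ Icc (0 : Fin k → ℝ) 1, f x ≤ 0 := by
  -- Step 1: for every ε > 0, `f ≤ k ε` on the cube.
  have step : ∀ ε : ℝ, 0 < ε → ∀ x ∈ Icc (0 : Fin k → ℝ) 1, f x ≤ (k : ℝ) * ε := by
    intro ε hε
    set F : (Fin k → ℝ) → ℝ := fun x => f x + ε * ∑ i, x i ^ 2 with hF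
    have hFcont : ContinuousOn F (Icc (0 : Fin k → ℝ) 1) := by
      refine hcont.add (Continuous.continuousOn ?_)
      exact continuous_const.mul (continuous_finsetSum _ fun i _ => (continuous_apply i).pow 2)
    have hne : (Icc (0 : Fin k → ℝ) 1).Nonempty := ⟨0, ⟨le_rfl, zero_le_one⟩⟩
    obtain ⟨xs, hxs, hmax⟩ := (isCompact_Icc : IsCompact (Icc (0 : Fin k → ℝ) 1)).exists_isMaxOn hne hFcont
    -- the maximiser is on the boundary
    have hb : ∃ i, xs i = 0 ∨ xs i = 1 := by
      by_contra hint
      have hint' : ∀ i, 0 < xs i ∧ xs i < 1 := fun i => by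
        have hi : ¬ (xs i = 0 ∨ xs i = 1) := fun h => hint ⟨i, h⟩
        exact ⟨lt_of_le_of_ne (hxs.1 i) (fun h => hi (Or.inl h.symm)), lt_of_le_of_ne (hxs.2 i) (fun h => hi (Or.inr h))⟩
      obtain ⟨i, g', D, hD0, hg, hgD⟩ := hdir xs hint'
      -- the line function of `F` through `xs` in direction `i`
      have hline : ∀ᶠ s in 𝓝 (xs i),
          HasDerivAt (fun s => F (Function.update xs i s)) (g' s + ε * (2 * s)) s := by
        filter_upwards [hg] with s hs using hs.add (hasDerivAt_perturb xs i ε s)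
      have hD : HasDerivAt (fun s => g' s + ε * (2 * s)) (D + ε * 2) (xs i) := by
        have h2 : HasDerivAt (fun s : ℝ => ε * (2 * s)) (ε * 2) (xs i) := by
          simpa using ((hasDerivAt_id (xs i)).const_mul 2).const_mul ε
        exact hgD.add h2
      have hpos : 0 < D + ε * 2 := by positivity
      have hlocmax : IsLocalMax (fun s => F (Function.update xs i s)) (xs i) := by
        have hnhd : Ioo (0 : ℝ) 1 ∈ 𝓝 (xs i) := Ioo_mem_nhds (hint' i).1 (hint' i).2
        filter_upwards [hnhd] with s hs
        have hmem : Function.update xs i s ∈ Icc (0 : Fin k → ℝ) 1 := update_mem_Icc hxs i ⟨hs.1.le, hs.2.le⟩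
        have := hmax hmem
        simpa [Function.update_eq_self] using this
      exact not_isLocalMax_of_hasDerivAt_deriv_pos hline hD hpos hlocmax
    -- conclude
    intro x hx
    have h1 : F x ≤ F xs := hmax hx
    have h2 : f xs ≤ 0 := hbdry xs hxs hb
    have h3 : ε * ∑ i, xs i ^ 2 ≤ ε * k := mul_le_mul_of_nonneg_left (sum_sq_le_card hxs) hε.le
    have h4 : 0 ≤ ε * ∑ i, x i ^ 2 := mul_nonneg hε.le (Finset.sum_nonneg fun i _ => sq_nonneg _)
    have h5 : f x ≤ F x := by simp only [hF]; linarith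
    calc f x ≤ F x := h5
      _ ≤ F xs := h1
      _ = f xs + ε * ∑ i, xs i ^ 2 := rfl
      _ ≤ (k : ℝ) * ε := by linarith
  -- Step 2: let ε → 0.
  intro x hx
  refine le_of_forall_pos_le_add fun ε hε => ?_
  have := step (ε / ((k : ℝ) + 1)) (by positivity) x hx
  have hk : (k : ℝ) * (ε / ((k : ℝ) + 1)) ≤ ε := by
    rw [mul_div_assoc']
    rw [div_le_iff₀ (by positivity)]
    nlinarith
  linarith

/-! ## The directional criterion for `Φ₄ = Q'⁴/(I'_A I'_b)²` (pure algebra)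

Along one pair weight all coordinates are affine; with the decrements `X = -∂ log Q'`, `A = -∂ log I'_A`, `B = -∂ log I'_b` one has
`Φ₄''/Φ₄ = ψ² + ψ'` with `ψ = -(4X - 2A - 2B)` and `ψ' = -4X² + 2A² + 2B²` (logarithmic derivative of a product of powers of affine
functions).  The next two lemmas are the algebra of memo §0/§2: the closed form `4(3X−S)(X−S) + 2(A²+B²)`, `S = A + B`, and its sign under
the decrement condition `XS` (`S ≤ X`, `0 ≤ X`) — in particular along every TERMINAL pair at the port (`X = A`, `B ≤ 0`). -/

/-- **`KEY₄` identity**: `(4X − 2A − 2B)² − 4X² + 2A² + 2B² = 4(3X − S)(X − S) + 2(A² + B²)` with `S = A + B`. [this work] -/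
theorem key4_identity (X A B : ℝ) :
    (4 * X - 2 * A - 2 * B) ^ 2 - 4 * X ^ 2 + 2 * A ^ 2 + 2 * B ^ 2
      = 4 * (3 * X - (A + B)) * (X - (A + B)) + 2 * (A ^ 2 + B ^ 2) := by
  ring

/-- **`XS ⟹` convex direction**: if `0 ≤ X` and `A + B ≤ X` then `KEY₄ ≥ 0` (both factors `3X − S = 2X + (X − S)` and `X − S` are
nonnegative).  `B` may be negative (the GAIN of the super-terminal law only helps). [this work] -/
theorem key4_nonneg_of_xs {X A B : ℝ} (hX : 0 ≤ X) (hXS : A + B ≤ X) :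
    0 ≤ 4 * (3 * X - (A + B)) * (X - (A + B)) + 2 * (A ^ 2 + B ^ 2) := by
  have h1 : 0 ≤ 3 * X - (A + B) := by linarith
  have h2 : 0 ≤ X - (A + B) := by linarith
  have h3 : 0 ≤ 4 * (3 * X - (A + B)) * (X - (A + B)) := by positivity
  nlinarith [sq_nonneg A, sq_nonneg B]

/-- **Terminal pairs are convex directions**: with `X = A` (the neighbour is a block vertex: `s` or `a`) and `B ≤ 0`, or with `A = 0`
(the neighbour is `b`), `KEY₄ ≥ 0`. [this work] -/
theorem key4_nonneg_terminal {X A B : ℝ} (hX : 0 ≤ X) (h : (X = A ∧ B ≤ 0) ∨ (A = 0 ∧ 0 ≤ B)) :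
    0 ≤ 4 * (3 * X - (A + B)) * (X - (A + B)) + 2 * (A ^ 2 + B ^ 2) := by
  rcases h with ⟨rfl, hB⟩ | ⟨rfl, hB⟩
  · exact key4_nonneg_of_xs hX (by linarith)
  · -- `A = 0`: `4(3X − B)(X − B) + 2B² = 12X² − 16XB + 6B² = 2(6X² − 8XB + 3B²)`, discriminant `64 − 72 < 0`
    nlinarith [sq_nonneg (3 * X - 2 * B), sq_nonneg X, sq_nonneg B]

end Summit.CriticalPhenomena.PercolationContinuityZ3.Theorems.PortCubeMaxPrinciple
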